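import Mathlib.Probability.Moments.Variance
import Summits.Ventures.YMGap.Thresholds.LatticeBakryEmeryWilson
import Summits.Ventures.YMGap.Thresholds.LatticeBakryEmeryPoincare
import Summits.Ventures.YMGap.Thresholds.SharpWindow
import Literature.MathematicalPhysics.QuantumFieldTheory.WilsonEnergyConvexity
import Literature.MathematicalPhysics.QuantumLattice.LatticeGaugeDLR
import HarnessLib

/-!
# Venture YMGap — the SHARP-WINDOW POINCARÉ INEQUALITY for lattice `SU(N)` Yang–Mills, kernel-checked:
# `Var_μ(F) ≤ (1/K) ∑_e L_e²`, `K = N/2 - 4dN|β|`, every torus and every tight limit, `|β| < 1/(8d)`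

HONEST FRAMING: venture file (cell `pub-ymgap`, track (a), seat p2). WHAT THIS IS: the Poincaré half
of Shen–Zhu–Zhu's Corollary 4.4/4.5 (CMP 400 (2023), (4.11)/(4.13) — the "dynamical" or
functional-inequality currency) for 't Hooft-scaled `SU(N)` lattice Yang–Mills, proved in the kernel
WITHOUT the named Bakry–Émery fact (`shenZhuZhu_bakryEmery_transfer`), from the multi-link
Bakry–Émery Poincaré inequality of `LatticeBakryEmeryPoincare.lean` and the venture's kernel Hessian
bound `WilsonHessianBound d N (4d)` (`wilsonHessianBound_four_d`): for every torus `Λ_L`, every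
`N ≥ 1`, `d ≥ 1` and every `β` with `K = N/2 - 4dN|β| > 0` (i.e. `|β| < 1/(8d)`), and every smooth
cylinder function that is `L_e`-Lipschitz in the link `e` (Frobenius distance),
`Var_{μ_{Λ_L,Nβ}}(F) ≤ (1/K) ∑_e L_e²` (`torus_variance_le`); hence the same for every infinite-volume
(tight) limit (`variance_le_of_mem_infiniteVolumeLimitPoints`), which is VERBATIM the variance clause
of `SZZFunctionalInequalitiesWith d N β K` (`sharp_poincare_clause`). WHAT IT IS NOT: the log-Sobolev
clause (entropy) of Cor. 4.5 is not proved here (it stays K-conditional on the named fact); no mass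
gap / clustering statement is made in this file; nothing at physical (weak) coupling.

## References

* H. Shen, R. Zhu, X. Zhu, CMP 400 (2023) 805–851, Theorem 4.2, Cor. 4.4 (4.11), Cor. 4.5 (4.13).
* D. Bakry, M. Émery, LNM 1123 (1985); Bakry–Gentil–Ledoux, Grundlehren 348, Prop. 4.8.1.
-/

noncomputable section

open scoped Matrix ComplexConjugate BigOperators Matrix.Norms.Frobenius ContDiff Topology ProbabilityTheory
open Matrix Complex Finset MeasureTheory Filter ProbabilityTheory
open Literature.MathematicalPhysics.QuantumFieldTheory
open Literature.MathematicalPhysics.QuantumLattice (fundamentalRep continuous_fundamentalRep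
  torusEdge torusLift toTorusObservable infiniteVolumeLimitPoints IsInfiniteVolumeLimitAlong IsCylinder)
open Literature.MathematicalPhysics.QuantumFieldTheory.SUNBakryEmery (SUN)

namespace Summit.Ventures.YMGap

namespace LatticeBakryEmery

universe u

/-! ### Torus expectations at tree coupling `Nβ` as `e^{wilsonPot}`-weighted Haar averages -/

section Torus

variable {d N : ℕ} {L : ℕ} [NeZero L]

/-- **Torus Wilson expectations as `e^{S}`-weighted product-Haar averages** with the polynomial
potential `S = wilsonPot β` (the constant `e^{-N²β|P|}` cancels). -/
theorem integral_wilsonMeasure_eq_div (β : ℝ) (φ : PSU (Edge d L) N → ℝ) :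
    ∫ U, φ U ∂(wilsonMeasure (d := d) (L := L) (fundamentalRep (Fin N)) ((N : ℝ) * β)) =
      (∫ U, Real.exp (wilsonPot d N L β (emb U)) * φ U ∂(haarPi (Edge d L) N)) /
        ∫ U, Real.exp (wilsonPot d N L β (emb U)) ∂(haarPi (Edge d L) N) := by
  have h := wilsonExpectation_eq_integral_div (d := d) (L := L) (fundamentalRep (Fin N))
    (continuous_fundamentalRep (n := Fin N)) ((N : ℝ) * β) φ
  unfold wilsonExpectation at h
  rw [h]
  set C : ℝ := Real.exp (-((N : ℝ) * β * N * Fintype.card (Plaquette d L))) with hC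
  have hCpos : 0 < C := Real.exp_pos _
  have e1 : (fun U : GaugeConfig d L (SUN N) => φ U * Real.exp (-((N : ℝ) * β) * wilsonAction (fundamentalRep (Fin N)) U))
      = fun U => C * (Real.exp (wilsonPot d N L β (emb U)) * φ U) := by
    funext U; rw [exp_neg_mul_wilsonAction_eq]; ring
  have e2 : (fun U : GaugeConfig d L (SUN N) => Real.exp (-((N : ℝ) * β) * wilsonAction (fundamentalRep (Fin N)) U))
      = fun U => C * Real.exp (wilsonPot d N L β (emb U)) := by
    funext U; rw [exp_neg_mul_wilsonAction_eq]
  show (∫ U, φ U * Real.exp (-((N : ℝ) * β) * wilsonAction (fundamentalRep (Fin N)) U) ∂(haarPi (Edge d L) N)) /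
      (∫ U, Real.exp (-((N : ℝ) * β) * wilsonAction (fundamentalRep (Fin N)) U) ∂(haarPi (Edge d L) N)) = _
  rw [e1, e2, integral_const_mul, integral_const_mul, mul_div_mul_left _ _ hCpos.ne']

/-- **Sharp-window Poincaré inequality on every torus** (Shen–Zhu–Zhu Cor. 4.4 (4.11) with `K_S`
replaced by `K = N/2 - N|β|Λ₀`, `Λ₀` any torus Hessian constant, e.g. `4d`): for a smooth function of
the link matrices that is `L_e`-Lipschitz in the link `e` on `SU(N)^{E⁺(Λ_L)}`,
`Var_{μ_{Λ_L,Nβ}}(F) ≤ (1/K) ∑_e L_e²`. Kernel theorem, no named fact. -/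
theorem torus_variance_le {Λ₀ : ℝ} (hH : WilsonHessianBound d N Λ₀) (hN : N ≠ 0) (β : ℝ)
    (hK : 0 < (N : ℝ) / 2 - N * |β| * Λ₀) {f : Cfg (Edge d L) N → ℝ} (hf : ContDiff ℝ ∞ f)
    {Lc : Edge d L → ℝ} (hL : ∀ e, 0 ≤ Lc e) (hLip : LinkLipschitz f Lc) :
    Var[fun U => f (emb U); wilsonMeasure (d := d) (L := L) (fundamentalRep (Fin N)) ((N : ℝ) * β)] ≤
      1 / ((N : ℝ) / 2 - N * |β| * Λ₀) * ∑ e, Lc e ^ 2 := by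
  set μ := wilsonMeasure (d := d) (L := L) (fundamentalRep (Fin N)) ((N : ℝ) * β) with hμ
  set S := wilsonPot d N L β with hS
  set Z : ℝ := ∫ U, Real.exp (S (emb U)) ∂(haarPi (Edge d L) N) with hZ
  have hSc : Continuous fun U : PSU (Edge d L) N => S (emb U) := continuous_restrict (contDiff_wilsonPot β)
  have hZpos : 0 < Z := integral_exp_pos (integrable_of_continuous_PSU (Real.continuous_exp.comp hSc) _)
  have hφc : Continuous fun U : PSU (Edge d L) N => f (emb U) := continuous_restrict hf
  set m : ℝ := (∫ U, Real.exp (S (emb U)) * f (emb U) ∂(haarPi (Edge d L) N)) / Z with hm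
  have hmean : ∫ U, f (emb U) ∂μ = m := integral_wilsonMeasure_eq_div β _
  have hvar : Var[fun U => f (emb U); μ] =
      (∫ U, Real.exp (S (emb U)) * (f (emb U) - m) ^ 2 ∂(haarPi (Edge d L) N)) / Z := by
    rw [variance_eq_integral hφc.measurable.aemeasurable]
    simp only [hmean]
    exact integral_wilsonMeasure_eq_div β _
  have hK' : 0 < (N : ℝ) / 2 - (N : ℝ) * |β| * Λ₀ := hK
  have hP := poincare_gibbs_lipschitz (ι := Edge d L) hN (wilsonPot_mem_polySpace β) (hessBound_wilsonPot hH β)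
    hK' hf hL hLip
  rw [hvar, div_le_iff₀ hZpos]
  rw [one_div, inv_mul_eq_div, div_mul_eq_mul_div, le_div_iff₀ hK', mul_comm]
  exact hP

/-- **Sharp-window Poincaré inequality on every torus, gradient (Dirichlet-form) form** (Shen–Zhu–Zhu
Cor. 4.4 (4.11) verbatim with `K_S` replaced by `K = N/2 - N|β|Λ₀`): for every smooth function `u` of the
link matrices, `Var_{μ_{Λ_L,Nβ}}(u) ≤ (1/K) ∫ Γ(u,u) dμ_{Λ_L,Nβ}`, `Γ(u,u) = ∑_e |∇_e u|²` the carré du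
champ of the product Hilbert–Schmidt metric — i.e. the Langevin dynamics has spectral gap `≥ K`
uniformly in the volume. Kernel theorem, no named fact. -/
theorem torus_variance_le_integral_Gam {Λ₀ : ℝ} (hH : WilsonHessianBound d N Λ₀) (hN : N ≠ 0) (β : ℝ)
    (hK : 0 < (N : ℝ) / 2 - N * |β| * Λ₀) {u : Cfg (Edge d L) N → ℝ} (hu : ContDiff ℝ ∞ u) :
    Var[fun U => u (emb U); wilsonMeasure (d := d) (L := L) (fundamentalRep (Fin N)) ((N : ℝ) * β)] ≤
      1 / ((N : ℝ) / 2 - N * |β| * Λ₀) *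
        ∫ U, Gam u u (emb U) ∂(wilsonMeasure (d := d) (L := L) (fundamentalRep (Fin N)) ((N : ℝ) * β)) := by
  set μ := wilsonMeasure (d := d) (L := L) (fundamentalRep (Fin N)) ((N : ℝ) * β) with hμ
  set S := wilsonPot d N L β with hS
  set Z : ℝ := ∫ U, Real.exp (S (emb U)) ∂(haarPi (Edge d L) N) with hZ
  have hSc : Continuous fun U : PSU (Edge d L) N => S (emb U) := continuous_restrict (contDiff_wilsonPot β)
  have hZpos : 0 < Z := integral_exp_pos (integrable_of_continuous_PSU (Real.continuous_exp.comp hSc) _)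
  have hφc : Continuous fun U : PSU (Edge d L) N => u (emb U) := continuous_restrict hu
  set m : ℝ := (∫ U, Real.exp (S (emb U)) * u (emb U) ∂(haarPi (Edge d L) N)) / Z with hm
  have hmean : ∫ U, u (emb U) ∂μ = m := integral_wilsonMeasure_eq_div β _
  have hvar : Var[fun U => u (emb U); μ] =
      (∫ U, Real.exp (S (emb U)) * (u (emb U) - m) ^ 2 ∂(haarPi (Edge d L) N)) / Z := by
    rw [variance_eq_integral hφc.measurable.aemeasurable]
    simp only [hmean]
    exact integral_wilsonMeasure_eq_div β _
  have hG : ∫ U, Gam u u (emb U) ∂μ = (∫ U, Real.exp (S (emb U)) * Gam u u (emb U) ∂(haarPi (Edge d L) N)) / Z :=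
    integral_wilsonMeasure_eq_div β _
  have hK' : 0 < (N : ℝ) / 2 - (N : ℝ) * |β| * Λ₀ := hK
  have hP := poincare_gibbs (ι := Edge d L) hN (wilsonPot_mem_polySpace β) (hessBound_wilsonPot hH β) hK' hu
  rw [hvar, hG, div_le_iff₀ hZpos, one_div, inv_mul_eq_div, div_mul_eq_mul_div, le_div_iff₀ hK',
    div_mul_cancel₀ _ hZpos.ne', mul_comm]
  exact hP

end Torus

/-! ### Passage to infinite-volume (tight) limits -/

section Limits

variable {d N : ℕ}

/-- Two distinct edges of `ℤ^d` have distinct images on all large tori. -/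
theorem eventually_torusEdge_ne {e e' : ZdEdge d} (h : e ≠ e') :
    ∀ᶠ L : ℕ in atTop, torusEdge (d := d) L e ≠ torusEdge L e' := by
  by_cases h2 : e.2 = e'.2
  · have h1 : e.1 ≠ e'.1 := fun h1 => h (Prod.ext h1 h2)
    obtain ⟨i, hi⟩ : ∃ i, e.1 i ≠ e'.1 i := by
      by_contra hc; push Not at hc; exact h1 (funext hc)
    refine (eventually_gt_atTop (e.1 i - e'.1 i).natAbs).mono fun L hL hEq => ?_
    have hc : (Literature.Probability.LatticeModels.Torus.proj L e.1) i =
        (Literature.Probability.LatticeModels.Torus.proj L e'.1) i := by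
      have := congrArg Prod.fst hEq
      simp only [torusEdge] at this
      rw [this]
    simp only [Literature.Probability.LatticeModels.Torus.proj_apply] at hc
    rw [ZMod.intCast_eq_intCast_iff_dvd_sub] at hc
    have hne : e'.1 i - e.1 i ≠ 0 := sub_ne_zero.2 (Ne.symm hi)
    have hle := Int.natAbs_le_of_dvd_ne_zero hc hne
    rw [Int.natAbs_natCast, ← Int.natAbs_neg, neg_sub] at hle
    omega
  · exact Eventually.of_forall fun L hEq => h2 (by simpa [torusEdge] using congrArg Prod.snd hEq)

/-- A finite edge set of `ℤ^d` projects injectively to all large tori. -/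
theorem eventually_injOn_torusEdge (Λ : Finset (ZdEdge d)) :
    ∀ᶠ L : ℕ in atTop, Set.InjOn (torusEdge (d := d) L) ↑Λ := by
  have h : ∀ᶠ L : ℕ in atTop, ∀ p ∈ Λ ×ˢ Λ, p.1 ≠ p.2 → torusEdge (d := d) L p.1 ≠ torusEdge L p.2 := by
    refine (Finset.eventually_all (Λ ×ˢ Λ)).2 fun p _ => ?_
    by_cases hp : p.1 = p.2
    · exact Eventually.of_forall fun L hne => absurd hp hne
    · exact (eventually_torusEdge_ne hp).mono fun L hL _ => hL
  refine h.mono fun L hL e he e' he' hEq => ?_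
  by_contra hne
  exact hL (e, e') (Finset.mk_mem_product he he') hne hEq

/-- **Sharp-window Poincaré inequality for every infinite-volume limit** (the variance clause of
Shen–Zhu–Zhu Cor. 4.5 (4.13), `K_S` replaced by `K = N/2 - N|β|Λ₀`): for every tight limit `μ` of
the torus states at tree coupling `Nβ` and every smooth cylinder function `F = f((U_e)_{e∈Λ})` that
is `L_e`-Lipschitz in the link `e`, `Var_μ(F) ≤ (1/K) ∑_e L_e²`. Kernel theorem, no named fact. -/
theorem variance_le_of_mem_infiniteVolumeLimitPoints {Λ₀ : ℝ} (hH : WilsonHessianBound d N Λ₀) (hN : N ≠ 0)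
    (β : ℝ) (hK : 0 < (N : ℝ) / 2 - N * |β| * Λ₀)
    {μ : Measure (Literature.MathematicalPhysics.QuantumLattice.LGConfig d (Matrix.specialUnitaryGroup (Fin N) ℂ))}
    (hμ : μ ∈ infiniteVolumeLimitPoints (d := d) (fundamentalRep (Fin N)) ((N : ℝ) * β))
    (Λ : Finset (ZdEdge d)) (f : (↥Λ → Matrix (Fin N) (Fin N) ℂ) → ℝ) (Lc : ↥Λ → ℝ)
    (hf : ContDiff ℝ ∞ f) (hL : ∀ e, 0 ≤ Lc e)
    (hLip : ∀ (e : ↥Λ) (M M' : ↥Λ → Matrix.specialUnitaryGroup (Fin N) ℂ),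
      (∀ e', e' ≠ e → M e' = M' e') →
        |f (fun e' => (M e' : Matrix (Fin N) (Fin N) ℂ)) - f (fun e' => (M' e' : Matrix (Fin N) (Fin N) ℂ))|
          ≤ Lc e * suFrobDist (M e) (M' e)) :
    Var[matrixCylinder Λ f; μ] ≤ 1 / ((N : ℝ) / 2 - N * |β| * Λ₀) * ∑ e, Lc e ^ 2 := by
  obtain ⟨Ls, hLs, hprob, hlim⟩ := hμ
  haveI := hprob
  set K : ℝ := (N : ℝ) / 2 - N * |β| * Λ₀ with hKdef
  set F : Literature.MathematicalPhysics.QuantumLattice.LGConfig d (Matrix.specialUnitaryGroup (Fin N) ℂ) → ℝ :=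
    matrixCylinder Λ f with hF
  -- `F` is a bounded continuous cylinder function, and so is `F²`
  have hFcyl : IsCylinder F Λ := isCylinder_matrixCylinder Λ f
  have hFc : Continuous F := by
    refine hf.continuous.comp ?_
    exact continuous_pi fun e => continuous_subtype_val.comp (continuous_apply _)
  obtain ⟨C, hC⟩ : ∃ C, ∀ U, |F U| ≤ C := by
    obtain ⟨C, hC⟩ := (isCompact_univ (X := Literature.MathematicalPhysics.QuantumLattice.LGConfig d
      (Matrix.specialUnitaryGroup (Fin N) ℂ))).exists_bound_of_continuousOn
      hFc.continuousOn
    exact ⟨C, fun U => by simpa [Real.norm_eq_abs] using hC U (Set.mem_univ _)⟩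
  have hF2cyl : IsCylinder (fun U => F U ^ 2) Λ := fun U V hUV => by
    show F U ^ 2 = F V ^ 2
    rw [hFcyl hUV]
  have hF2c : Continuous fun U => F U ^ 2 := hFc.pow 2
  have hC2 : ∃ C', ∀ U, |F U ^ 2| ≤ C' := ⟨C ^ 2, fun U => by
    rw [abs_pow]; exact pow_le_pow_left₀ (abs_nonneg _) (hC U) 2⟩
  have ht1 := hlim F Λ hFcyl hFc ⟨C, hC⟩
  have ht2 := hlim (fun U => F U ^ 2) Λ hF2cyl hF2c hC2
  -- the variance of `μ` as a limit of torus variances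
  have hFm : AEStronglyMeasurable F μ := hFc.aestronglyMeasurable
  have hmem : MemLp F 2 μ := MemLp.of_bound hFm C (ae_of_all _ fun U => by
    rw [Real.norm_eq_abs]; exact hC U)
  have hvarμ : Var[F; μ] = (∫ U, F U ^ 2 ∂μ) - (∫ U, F U ∂μ) ^ 2 := by
    rw [variance_eq_sub hmem]
    rfl
  have htv : Tendsto (fun k => wilsonExpectation (L := Ls k + 1) (fundamentalRep (Fin N)) ((N : ℝ) * β)
        (toTorusObservable (Ls k + 1) fun U => F U ^ 2) -
      wilsonExpectation (L := Ls k + 1) (fundamentalRep (Fin N)) ((N : ℝ) * β) (toTorusObservable (Ls k + 1) F) ^ 2)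
      atTop (𝓝 (Var[F; μ])) := by
    rw [hvarμ]
    exact ht2.sub (ht1.pow 2)
  -- the torus variances are eventually bounded by `(1/K) ∑ L_e²`
  have hev : ∀ᶠ k : ℕ in atTop,
      wilsonExpectation (L := Ls k + 1) (fundamentalRep (Fin N)) ((N : ℝ) * β)
          (toTorusObservable (Ls k + 1) fun U => F U ^ 2) -
        wilsonExpectation (L := Ls k + 1) (fundamentalRep (Fin N)) ((N : ℝ) * β) (toTorusObservable (Ls k + 1) F) ^ 2
        ≤ 1 / K * ∑ e, Lc e ^ 2 := by
    have hinj : ∀ᶠ k : ℕ in atTop, Set.InjOn (torusEdge (d := d) (Ls k + 1)) ↑Λ := by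
      have h1 := eventually_injOn_torusEdge (d := d) Λ
      have h2 : Tendsto (fun k => Ls k + 1) atTop atTop :=
        tendsto_atTop_mono (fun k => Nat.le_succ (Ls k)) hLs.tendsto_atTop
      exact h2.eventually h1
    refine hinj.mono fun k hk => ?_
    set L' : ℕ := Ls k + 1 with hL'
    -- the cylinder function on the torus `Λ_{L'}` as a function of ALL torus links
    set g : Cfg (Edge d L') N → ℝ := fun Q => f fun e : ↥Λ => Q (torusEdge L' (e : ZdEdge d)) with hg
    have hgc : ContDiff ℝ ∞ g := by
      refine hf.comp ?_
      exact contDiff_pi.2 fun e => contDiff_apply ℝ _ (torusEdge L' (e : ZdEdge d))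
    -- its per-torus-link Lipschitz constants
    set Lt : Edge d L' → ℝ := fun e' => ∑ e : ↥Λ, if torusEdge L' (e : ZdEdge d) = e' then Lc e else 0 with hLt
    have hLt0 : ∀ e', 0 ≤ Lt e' := fun e' => sum_nonneg fun e _ => by
      split_ifs
      · exact hL e
      · exact le_rfl
    have hLipg : LinkLipschitz g Lt := by
      intro e' a b hab
      by_cases hex : ∃ e₀ : ↥Λ, torusEdge L' (e₀ : ZdEdge d) = e'
      · obtain ⟨e₀, he₀⟩ := hex
        have huniq : ∀ e : ↥Λ, e ≠ e₀ → torusEdge L' (e : ZdEdge d) ≠ e' := by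
          intro e hne hEq
          apply hne
          exact Subtype.ext (hk e.2 e₀.2 (hEq.trans he₀.symm))
        have hLt' : Lt e' = Lc e₀ := by
          simp only [hLt]
          rw [Finset.sum_eq_single e₀]
          · rw [if_pos he₀]
          · intro e _ hne; rw [if_neg (huniq e hne)]
          · intro h; exact absurd (mem_univ _) h
        have hdiff := hLip e₀ (fun e => a (torusEdge L' (e : ZdEdge d))) (fun e => b (torusEdge L' (e : ZdEdge d)))
          (fun e hne => hab _ (huniq e hne))
        rw [hLt']
        simpa [hg, emb, he₀] using hdiff
      · push Not at hex
        have hsame : (fun e : ↥Λ => emb a (torusEdge L' (e : ZdEdge d))) = fun e : ↥Λ => emb b (torusEdge L' (e : ZdEdge d)) := by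
          funext e
          simp only [emb_apply]
          rw [hab _ (hex e)]
        have h0 : g (emb a) - g (emb b) = 0 := by
          simp only [hg]
          rw [show (fun e : ↥Λ => emb a (torusEdge L' (e : ZdEdge d))) = fun e : ↥Λ => emb b (torusEdge L' (e : ZdEdge d))
            from hsame, sub_self]
        rw [h0, abs_zero]
        exact mul_nonneg (hLt0 e') (suFrobDist_nonneg _ _)
    -- `∑_{e'} Lt_{e'}² = ∑_e Lc_e²` by injectivity
    have hsumLt : ∑ e', Lt e' ^ 2 = ∑ e : ↥Λ, Lc e ^ 2 := by
      have hsq : ∀ e', Lt e' ^ 2 = ∑ e : ↥Λ, if torusEdge L' (e : ZdEdge d) = e' then Lc e ^ 2 else 0 := by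
        intro e'
        by_cases hex : ∃ e₀ : ↥Λ, torusEdge L' (e₀ : ZdEdge d) = e'
        · obtain ⟨e₀, he₀⟩ := hex
          have huniq : ∀ e : ↥Λ, e ≠ e₀ → torusEdge L' (e : ZdEdge d) ≠ e' := by
            intro e hne hEq
            exact hne (Subtype.ext (hk e.2 e₀.2 (hEq.trans he₀.symm)))
          simp only [hLt]
          rw [Finset.sum_eq_single e₀, Finset.sum_eq_single e₀, if_pos he₀, if_pos he₀]
          · intro e _ hne; rw [if_neg (huniq e hne)]
          · intro h; exact absurd (mem_univ _) h
          · intro e _ hne; rw [if_neg (huniq e hne)]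
          · intro h; exact absurd (mem_univ _) h
        · push Not at hex
          simp only [hLt]
          rw [Finset.sum_eq_zero fun e _ => if_neg (hex e), Finset.sum_eq_zero fun e _ => if_neg (hex e)]
          ring
      simp_rw [hsq]
      rw [Finset.sum_comm]
      refine sum_congr rfl fun e _ => ?_
      rw [Finset.sum_ite_eq univ (torusEdge L' (e : ZdEdge d)) (fun _ => Lc e ^ 2)]
      simp
    -- the torus variance bound
    have hT := torus_variance_le (d := d) (L := L') hH hN β hK hgc hLt0 hLipg
    rw [hsumLt] at hT
    -- identify the torus variance with the Wilson expectations of `F², F`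
    haveI := isProbabilityMeasure_wilsonMeasure (d := d) (L := L') (fundamentalRep (Fin N))
      (continuous_fundamentalRep (n := Fin N)) ((N : ℝ) * β)
    have hgF : (fun U : PSU (Edge d L') N => g (emb U)) = toTorusObservable L' F := by
      funext U; rfl
    have hgc' : Continuous fun U : PSU (Edge d L') N => g (emb U) := continuous_restrict hgc
    have hmemk : MemLp (fun U : PSU (Edge d L') N => g (emb U)) 2
        (wilsonMeasure (d := d) (L := L') (fundamentalRep (Fin N)) ((N : ℝ) * β)) :=
      MemLp.of_bound hgc'.aestronglyMeasurable C (ae_of_all _ fun U => by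
        rw [Real.norm_eq_abs]; exact hC (torusLift L' U))
    have hvk : Var[fun U : PSU (Edge d L') N => g (emb U);
        wilsonMeasure (d := d) (L := L') (fundamentalRep (Fin N)) ((N : ℝ) * β)] =
        wilsonExpectation (L := L') (fundamentalRep (Fin N)) ((N : ℝ) * β) (toTorusObservable L' fun U => F U ^ 2) -
          wilsonExpectation (L := L') (fundamentalRep (Fin N)) ((N : ℝ) * β) (toTorusObservable L' F) ^ 2 := by
      rw [variance_eq_sub hmemk, hgF]
      rfl
    rw [← hvk]
    exact hT
  exact le_of_tendsto htv hev

/-- **The sharp window**: with the venture's kernel Hessian constant `Λ₀ = 4d`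
(`wilsonHessianBound_four_d`), for every `N ≥ 1`, `d ≥ 1` and `|β| < 1/(8d)` ('t Hooft scaling;
`d = 4`: `1/32` vs the printed `1/48`), every tight limit satisfies the Poincaré inequality
`Var_μ(F) ≤ (1/K) ∑_e L_e²` with `K = N/2 - 4dN|β| = sharpBakryEmeryConstSU N d β` — the VARIANCE CLAUSE
of `SZZFunctionalInequalitiesWith d N β K` (the conclusion shape of the named fact
`shenZhuZhu_bakryEmery_transfer`), now a hypothesis-free kernel theorem. -/
theorem sharp_poincare_clause (hd : 1 ≤ d) (hN : 1 ≤ N) {β : ℝ}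
    (hβ : |β| < HessianSharp.sharpThresholdSU d)
    {μ : Measure (Literature.MathematicalPhysics.QuantumLattice.LGConfig d (Matrix.specialUnitaryGroup (Fin N) ℂ))}
    (hμ : μ ∈ infiniteVolumeLimitPoints (d := d) (fundamentalRep (Fin N)) ((N : ℝ) * β))
    (Λ : Finset (ZdEdge d)) (f : (↥Λ → Matrix (Fin N) (Fin N) ℂ) → ℝ) (Lc : ↥Λ → ℝ)
    (hf : ContDiff ℝ ∞ f) (hL : ∀ e, 0 ≤ Lc e)
    (hLip : ∀ (e : ↥Λ) (M M' : ↥Λ → Matrix.specialUnitaryGroup (Fin N) ℂ),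
      (∀ e', e' ≠ e → M e' = M' e') →
        |f (fun e' => (M e' : Matrix (Fin N) (Fin N) ℂ)) - f (fun e' => (M' e' : Matrix (Fin N) (Fin N) ℂ))|
          ≤ Lc e * suFrobDist (M e) (M' e)) :
    Var[matrixCylinder Λ f; μ] ≤ 1 / HessianSharp.sharpBakryEmeryConstSU N d β * ∑ e, Lc e ^ 2 := by
  have hK : 0 < HessianSharp.sharpBakryEmeryConstSU N d β := (HessianSharp.sharpBakryEmeryConstSU_pos_iff hd hN β).2 hβ
  rw [HessianSharp.sharpBakryEmeryConstSU_eq] at hK ⊢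
  exact variance_le_of_mem_infiniteVolumeLimitPoints (HessianSharp.wilsonHessianBound_four_d (d := d) (N := N))
    (by omega) β hK hμ Λ f Lc hf hL hLip

end Limits

end LatticeBakryEmery

end Summit.Ventures.YMGap
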